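import Mathlib
import Literature.Probability.LatticeModels.LatticeLaplacianZd

/-!
# The pointwise Kenyon stencil behind `stub_greenMajorant` (line `kenyon-stream-second-relation`,
crux stmt-CriticalPhenomena-11293) — kernel-checked, for the prover of STUB 3

Standing disprover `refuter-cdisprove-stmt-CriticalPhenomena-11293-g3-0`, cycle 3 (evidence, not a
landing: a POSITIVE helper).  The skeleton `Lines/kenyon-stream-second-relation.lean` is not an
importable module, so its combinatorial definitions `ex, classOffset, classComp, cornersAt, vRes, sRes`
are copied VERBATIM below (namespace `…Cruxes.ParafermionPrecompact.Disproof.Stencil`); the theorems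
transfer to the skeleton by copy-paste.

Content.  With `g q v := classComp Φ q v = Φ (v, v + classOffset q)` (the four class components) the
residuals read (`vRes_eq`, `sRes_eq`, by `fin_cases`):
* horizontal edge `(x, 0)`: `NW ↦ g 0 x`, `NE ↦ g 1 (x+e₀)`, `SE ↦ g 2 (x+e₀)`, `SW ↦ g 3 x`;
* vertical edge `(x, 1)`:   `NW ↦ g 2 (x+e₁)`, `NE ↦ g 3 (x+e₁)`, `SE ↦ g 0 x`, `SW ↦ g 1 x`;
and the (unnormalised, `latticeLaplacianZd`-shaped) Laplacian of EVERY class component is an explicit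
combination of six `sRes` and six `vRes` at edges within sup-distance `1` (`stencil_0 … stencil_3`,
coefficients in `{±1, ±i, (±1±i)/2}`, found by exact elimination over `ℚ(i)`; the representation is
UNIQUE given these twelve generators).  The `sRes`-coefficients have the gradient structure
`α_{q,i}(𝟙_{p.1 = y} - 𝟙_{p.1+eᵢ = y}) + β_{q,i}(𝟙_{faceA p - c_q = y} - 𝟙_{faceB p - c_q = y})` with
`|α|, |β| = 1/√2`, so after `green_representation` the `sRes`-part of `Σ_y G_Λ(x₀,y)(-Δ g_q)(y)` is
bounded by `(1/√2)·Σ_p greenWeight Λ x₀ q p · ‖sRes Φ p‖` — the inequality of `Sig.stub_greenMajorant`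
with room `√2` (randomised check of the full single-point and pair inequalities on seven shapes
`|Λ| ≤ 9`: worst ratios `0.45` / `0.44`, script `py/majorant_check.py`).  STUB 3 is therefore TRUE as
typed; this file is the `simp; ring` certificate the line card promises ("the identity itself is
`simp; ring` once the 14 coefficients are typed").
-/

noncomputable section

namespace Summit.CriticalPhenomena.CardyFormulaZ2.Cruxes.ParafermionPrecompact.Disproof.Stencil

open Literature.Probability.LatticeModels

/-! ### Verbatim copies of the skeleton's combinatorial definitions -/

/-- Unit vector `eᵢ` of `ℤ²` (skeleton `ex`). -/
def ex (i : Fin 2) : Site 2 := Pi.single i 1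

/-- The four corner classes (skeleton `classOffset`). -/
def classOffset : Fin 4 → Site 2 := ![0, -ex 0, -ex 0 - ex 1, -ex 1]

/-- Class component (skeleton `classComp`). -/
def classComp (Φ : Site 2 × Site 2 → ℂ) (q : Fin 4) (v : Site 2) : ℂ := Φ (v, v + classOffset q)

/-- Corners at a medial vertex, clockwise `NW, NE, SE, SW` (skeleton `cornersAt`). -/
def cornersAt (x : Site 2) : Fin 2 → Fin 4 → Site 2 × Site 2
  | 0 => ![(x, x), (x + ex 0, x), (x + ex 0, x - ex 1), (x, x - ex 1)]
  | 1 => ![(x + ex 1, x - ex 0), (x + ex 1, x), (x, x), (x, x - ex 0)]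

/-- Vertex residual (skeleton `vRes`). -/
def vRes (Φ : Site 2 × Site 2 → ℂ) (p : Site 2 × Fin 2) : ℂ :=
  Φ (cornersAt p.1 p.2 0) - Φ (cornersAt p.1 p.2 2) -
    Complex.I * (Φ (cornersAt p.1 p.2 1) - Φ (cornersAt p.1 p.2 3))

/-- Sum residual (skeleton `sRes`). -/
def sRes (Φ : Site 2 × Site 2 → ℂ) (p : Site 2 × Fin 2) : ℂ :=
  Φ (cornersAt p.1 p.2 0) - Φ (cornersAt p.1 p.2 1) + Φ (cornersAt p.1 p.2 2) - Φ (cornersAt p.1 p.2 3)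

/-! ### The residuals in class coordinates -/

/-- `sRes` in class coordinates `g q v = Φ (v, v + c_q)`. -/
def sResG (g : Fin 4 → Site 2 → ℂ) (x : Site 2) : Fin 2 → ℂ
  | 0 => g 0 x - g 1 (x + ex 0) + g 2 (x + ex 0) - g 3 x
  | 1 => g 2 (x + ex 1) - g 3 (x + ex 1) + g 0 x - g 1 x

/-- `vRes` in class coordinates. -/
def vResG (g : Fin 4 → Site 2 → ℂ) (x : Site 2) : Fin 2 → ℂ
  | 0 => g 0 x - g 2 (x + ex 0) - Complex.I * (g 1 (x + ex 0) - g 3 x)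
  | 1 => g 2 (x + ex 1) - g 0 x - Complex.I * (g 3 (x + ex 1) - g 1 x)

/-- The unnormalised five-point Laplacian of the class-`q` component (shape of
`latticeLaplacianZd`: neighbour sum minus `4 ×` centre). -/
def lapG (g : Fin 4 → Site 2 → ℂ) (q : Fin 4) (y : Site 2) : ℂ :=
  g q (y + ex 0) + g q (y - ex 0) + g q (y + ex 1) + g q (y - ex 1) - 4 * g q y

theorem site_aux₁ (x : Site 2) : x + ex 0 + (-ex 0 - ex 1) = x - ex 1 := by abel
theorem site_aux₃ (x : Site 2) (i : Fin 2) : x + -ex i = x - ex i := (sub_eq_add_neg _ _).symm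

/-- Bridge: `sRes Φ (x, i) = sResG (classComp Φ) x i`. -/
theorem sRes_eq (Φ : Site 2 × Site 2 → ℂ) (x : Site 2) (i : Fin 2) :
    sRes Φ (x, i) = sResG (classComp Φ) x i := by
  fin_cases i <;>
    simp [sRes, sResG, cornersAt, classComp, classOffset, site_aux₁, site_aux₃]

/-- Bridge: `vRes Φ (x, i) = vResG (classComp Φ) x i`. -/
theorem vRes_eq (Φ : Site 2 × Site 2 → ℂ) (x : Site 2) (i : Fin 2) :
    vRes Φ (x, i) = vResG (classComp Φ) x i := by
  fin_cases i <;>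
    simp [vRes, vResG, cornersAt, classComp, classOffset, site_aux₁, site_aux₃]

/-- The Laplacian of the skeleton: real and imaginary parts of `lapG` are `latticeLaplacianZd` of the
real and imaginary parts of the class component. -/
theorem lapG_re (g : Fin 4 → Site 2 → ℂ) (q : Fin 4) (y : Site 2) :
    (lapG g q y).re = latticeLaplacianZd (fun v => (g q v).re) y := by
  simp [lapG, latticeLaplacianZd, Fin.sum_univ_two, ex]
  ring

/-! ### The four stencil identities (exact, all `Φ`; coefficients by elimination over `ℚ(i)`) -/

theorem stencil_0 (g : Fin 4 → Site 2 → ℂ) (y : Site 2) :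
    lapG g 0 y =
      (((1:ℂ)/2) + ((-1:ℂ)/2) * Complex.I) * vResG g (y - ex 0) 0 +
      (((-1:ℂ)/2) + ((-1:ℂ)/2) * Complex.I) * vResG g (y - ex 1) 1 +
      ((-1:ℂ)) * vResG g (y) 0 +
      ((1:ℂ)) * vResG g (y) 1 +
      (((1:ℂ)/2) + ((1:ℂ)/2) * Complex.I) * vResG g (y + ex 1) 0 +
      (((-1:ℂ)/2) + ((1:ℂ)/2) * Complex.I) * vResG g (y + ex 0) 1 +
      (((1:ℂ)/2) + ((1:ℂ)/2) * Complex.I) * sResG g (y - ex 0) 0 +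
      (((1:ℂ)/2) + ((-1:ℂ)/2) * Complex.I) * sResG g (y - ex 1) 1 +
      ((-1:ℂ)) * sResG g (y) 0 +
      ((-1:ℂ)) * sResG g (y) 1 +
      (((1:ℂ)/2) + ((-1:ℂ)/2) * Complex.I) * sResG g (y + ex 1) 0 +
      (((1:ℂ)/2) + ((1:ℂ)/2) * Complex.I) * sResG g (y + ex 0) 1 := by
  simp only [lapG, sResG, vResG]
  ring_nf
  simp only [Complex.I_sq]
  ring_nf

theorem stencil_1 (g : Fin 4 → Site 2 → ℂ) (y : Site 2) :
    lapG g 1 y =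
      ((-1:ℂ) * Complex.I) * vResG g (y - ex 0) 0 +
      (((1:ℂ)/2) + ((-1:ℂ)/2) * Complex.I) * vResG g (y - ex 0) 1 +
      (((1:ℂ)/2) + ((1:ℂ)/2) * Complex.I) * vResG g (y - ex 0 + ex 1) 0 +
      (((-1:ℂ)/2) + ((-1:ℂ)/2) * Complex.I) * vResG g (y - ex 1) 1 +
      (((-1:ℂ)/2) + ((1:ℂ)/2) * Complex.I) * vResG g (y) 0 +
      ((1:ℂ) * Complex.I) * vResG g (y) 1 +
      ((1:ℂ)) * sResG g (y - ex 0) 0 +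
      (((-1:ℂ)/2) + ((1:ℂ)/2) * Complex.I) * sResG g (y - ex 0) 1 +
      (((-1:ℂ)/2) + ((-1:ℂ)/2) * Complex.I) * sResG g (y - ex 0 + ex 1) 0 +
      (((-1:ℂ)/2) + ((-1:ℂ)/2) * Complex.I) * sResG g (y - ex 1) 1 +
      (((-1:ℂ)/2) + ((1:ℂ)/2) * Complex.I) * sResG g (y) 0 +
      ((1:ℂ)) * sResG g (y) 1 := by
  simp only [lapG, sResG, vResG]
  ring_nf
  simp only [Complex.I_sq]
  ring_nf

theorem stencil_2 (g : Fin 4 → Site 2 → ℂ) (y : Site 2) :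
    lapG g 2 y =
      (((-1:ℂ)/2) + ((-1:ℂ)/2) * Complex.I) * vResG g (y - ex 0 - ex 1) 0 +
      (((1:ℂ)/2) + ((-1:ℂ)/2) * Complex.I) * vResG g (y - ex 0 - ex 1) 1 +
      ((1:ℂ)) * vResG g (y - ex 0) 0 +
      ((-1:ℂ)) * vResG g (y - ex 1) 1 +
      (((-1:ℂ)/2) + ((1:ℂ)/2) * Complex.I) * vResG g (y) 0 +
      (((1:ℂ)/2) + ((1:ℂ)/2) * Complex.I) * vResG g (y) 1 +
      (((1:ℂ)/2) + ((-1:ℂ)/2) * Complex.I) * sResG g (y - ex 0 - ex 1) 0 +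
      (((1:ℂ)/2) + ((1:ℂ)/2) * Complex.I) * sResG g (y - ex 0 - ex 1) 1 +
      ((-1:ℂ)) * sResG g (y - ex 0) 0 +
      ((-1:ℂ)) * sResG g (y - ex 1) 1 +
      (((1:ℂ)/2) + ((1:ℂ)/2) * Complex.I) * sResG g (y) 0 +
      (((1:ℂ)/2) + ((-1:ℂ)/2) * Complex.I) * sResG g (y) 1 := by
  simp only [lapG, sResG, vResG]
  ring_nf
  simp only [Complex.I_sq]
  ring_nf

theorem stencil_3 (g : Fin 4 → Site 2 → ℂ) (y : Site 2) :
    lapG g 3 y =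
      (((1:ℂ)/2) + ((-1:ℂ)/2) * Complex.I) * vResG g (y - ex 0) 0 +
      (((-1:ℂ)/2) + ((-1:ℂ)/2) * Complex.I) * vResG g (y - ex 1) 0 +
      ((-1:ℂ) * Complex.I) * vResG g (y - ex 1) 1 +
      ((1:ℂ) * Complex.I) * vResG g (y) 0 +
      (((1:ℂ)/2) + ((1:ℂ)/2) * Complex.I) * vResG g (y) 1 +
      (((-1:ℂ)/2) + ((1:ℂ)/2) * Complex.I) * vResG g (y + ex 0 - ex 1) 1 +
      (((-1:ℂ)/2) + ((1:ℂ)/2) * Complex.I) * sResG g (y - ex 0) 0 +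
      (((-1:ℂ)/2) + ((-1:ℂ)/2) * Complex.I) * sResG g (y - ex 1) 0 +
      ((1:ℂ)) * sResG g (y - ex 1) 1 +
      ((1:ℂ)) * sResG g (y) 0 +
      (((-1:ℂ)/2) + ((-1:ℂ)/2) * Complex.I) * sResG g (y) 1 +
      (((-1:ℂ)/2) + ((1:ℂ)/2) * Complex.I) * sResG g (y + ex 0 - ex 1) 1 := by
  simp only [lapG, sResG, vResG]
  ring_nf
  simp only [Complex.I_sq]
  ring_nf

end Summit.CriticalPhenomena.CardyFormulaZ2.Cruxes.ParafermionPrecompact.Disproof.Stencil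

end
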